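import Summits.QuantumFields.BalabanUV.Beta.FP.PerfectBubbleSandwich
import Summits.QuantumFields.BalabanUV.Beta.D1BFx.FineHessianWard

/-!
# `BalabanUV.Beta.FP.PerfectColumnKronecker` — road «FP» for binder row D1, supplier row «hT1-from-reflection» (owner ruling R-FP-8 (2)),
# ROOTING-INDEPENDENT HALF, part 1: THE KRONECKER FIRST-MOMENT ROW OF THE PERFECT TRANSPORT COLUMN — the off-diagonal (L1∞) constants
# VANISH, from affine reproduction, through decimation and the dominated limit `j → ∞`; UNCONDITIONAL for `d = 3`, `2 ≤ Lc`, every `m ≥ 1`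
# (part 2, `FP/PerfectSandwichWard`: the REP∞ ENDs re-pointed with `hT1` replaced by first-bond divergence-freeness)

HONEST DEPENDENCY (page 1, mandatory): continuum YM on T⁴ ⇐ BetaPertH ∧ nine spine estimates (0/9 proved); BetaPertH ⇐ (D1) ∧ (D4) ∧
CAP+tail; G-an2-4 gates asym, D1 and NE2/3/4.  HONEST FRAMING (cell contract, verbatim): «discharging `BetaPertH` makes Bałaban's UV
stability UNCONDITIONAL — a real constructive-QFT result; it is NOT the continuum limit and NOT the Clay problem.»  THIS MODULE DISCHARGES
NOTHING of D1 / BetaPertH: [folklore] bookkeeping BY NAME over an2's `KernelRepresentationSummable` (the computation inside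
`linReproSum_of_reproduces`, kept to its off-diagonal value), `KernelSpecInstance.lowMomentsSum_specK`, leaf-06/owner's `FP/TransportInfinityM`
∕ `FP/TransportLimit` ∕ `FP/KSlotHolds` ∕ `GAN24.RealRateKMHolds` (the perfect column as a dominated limit, rebase), this lineage's
`FP/PerfectBubbleSandwich` (gen 3: the base-`0` column letters).  No `def`, no `Prop` mirror, no cited fact, 0 sorry; 0 wall binders; NOT hrep, NOT
D1, NOT BetaPertH, NOT continuum, NOT Clay.

ABSOLUTE RULE (cell charter, verbatim): «No internally-minted statement may enter as a cited fact. Every hypothesis is either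
kernel-proved in this package or a verbatim quotation of a PUBLISHED theorem with page reference. The manuscript(s) under audit are NOT
citable for their own disputed steps — they are the thing under adjudication; programme-internal (2001/route/tribunal) claims are never
citable.»

WHY.  The REP∞ files of record carry `hT1` (ALL base-point-summed first moments of every entry of `fineHessA (Π K Π) (Πᵀ S) Wf`), whose only
supplier is a reflection covariance the corner-rooted `Π` of record does not have (leaf-02-g3 caution, CLAIMS 2026-08-20T13:55:25Z; an5
`CornerRootInstance`).  beta-num-g36's exact check (CLAIMS 13:48:10Z) located the escape: «`hT1` … can be traded only for the structural row
`LinReproSum N (w κ l) (if κ = l then C else 0)` … not currently derived for `wK`».  §1–§3 DERIVE that row (off-diagonal constants `= 0`; the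
diagonal constants stay free, which `MomentTransferKronecker` shows is enough at the entries `κ, λ ∈ {a, b}`): the test form `affine (unitMat l j) 0`
of an2's `linReproSum_of_reproduces` has `κ`-component `[κ = l]·x_j`, so its contour sum — the only source of the (L1∞) constant — VANISHES for
`κ ≠ l`; the zero passes through decimation/dilation (`stepColM`, `wStepM`) and through the dominated limit `j → ∞` to the perfect column
`colOf (KPerf … m)`.  Part 2 (`FP/PerfectSandwichWard`) then re-points the REP∞ ENDs at `(κ, λ) = (μ, ν)` with `hT1` replaced by FIRST-BOND
DIVERGENCE-FREENESS of the full fine kernel — the datum from which leaf-01's `FineHessianWard.divFree_fineHessA_of_wardLaws` already manufactures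
`hrow` ((W1)/(W2) of an2's `KernelWard.ward_hess`; adapter §4 here).

CONTENT (all [folklore] / [our object]).
* §1 `linReproSum_of_reproduces_offDiag` (generic), `linReproSum_of_spec_offDiag`, `linReproSum_wH_offDiag` (`KernelSpecInstance.wH` =
  `MinimiserIdentityForm.wK` at `d + 1 = 4`).
* §2 `linReproSum_stepColM_offDiag`, `linReproSum_wStepM_offDiag` (every finite step `j`).
* §3 `linReproSum_colOf_offDiag` (dominated limit), `linReproSum_perfCol_offDiag` (generic units), **`linReproSum_perfCol_one_offDiag_holds`**,
  **`linReproSum_perfCol_offDiag_holds`** (`d = 3`, `2 ≤ Lc`, every `m ≥ 1`: UNCONDITIONAL).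
* §4 packaging: `linReproSum_kronecker_of_offDiag` (the Kronecker SHAPE consumed by `D1BFx/MomentTransferKronecker`), `linReproSum_colH_zero_offDiag`,
  `divFree_single_of_unitVec` (leaf-01's `unitVec` spelling ⟹ the `Pi.single` spelling of `D1BFx/MomentTransferKroneckerWard`).
Unit `b2b-balaban-beta-d1-formalise-leaf-02` (gen 4).
-/

noncomputable section

namespace Summit.QuantumFields.BalabanUV.Beta.FP.PerfectColumnKronecker

open Finset Filter Topology
open scoped BigOperators
open Literature.MathematicalPhysics.QuantumFieldTheory.Balaban1983to89
open Literature.MathematicalPhysics.QuantumFieldTheory.Balaban1983to89.Beta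
open B12Sec2to5 (l1)
open B6BondElimination (unitVec)
open AffineAveraging (Form1 affine contourSum contourSum_affine)
open AffineReproduction (cst InfiniteVolumeSpec hAff_of_spec)
open DecimatedMoment (cosetInd)
open DecimatedMomentSummable (ConstReproSum LinReproSum AbsMoment₂ summable_of_absMoment₂)
open KernelRepresentation (unitMat)
open KernelRepresentationSummable (kernelOpSum cM0Sum cM1Sum hasSum_cM0Sum hasSum_cM1Sum constReproSum_of_reproduces kernelOpSum_affine)
open KernelSpecInstance (wH specK absMoment₂_wH lowMomentsSum_specK)
open DressedMomentNormalisation (EKer resSite EntryHyps)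
open ExpKernelCalculus (Site MKer Decays BiLoc shiftK)
open OneStepResolventKernel (Fib LocStencil)
open OneStepKernelFamily (colH LegIdx)
open HessianTelescopingKKT (legOff linReproSum_dilate linReproSum_const_mul)
open Summit.QuantumFields.BalabanUV.Beta.TameKernelCalculus
open Summit.QuantumFields.BalabanUV.Beta.HessKerDressedUnits (unitK)
open Summit.QuantumFields.BalabanUV.Beta.GAN24.CombesThomas (sfStep smStep)
open Summit.QuantumFields.BalabanUV.Beta.GAN24.KSlotAssembly (convCKWall_holds)
open Summit.QuantumFields.BalabanUV.Beta.GAN24.RealRateKMHolds (KPerf_eq_KPerf_pow_base_holds)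
open Summit.QuantumFields.BalabanUV.Beta.D1BFx.MomentTransferPeriodic (Ker₂ IsBlockPeriodic baseKer)
open Summit.QuantumFields.BalabanUV.Beta.D1BFx.MomentTransferPeriodicEntry (EKer₂ dressedEntryP avgM2)
open Summit.QuantumFields.BalabanUV.Beta.D1BFx.FineHessianWard (unitVec_eq_single)
open Summit.QuantumFields.BalabanUV.Beta.FP.PerfectObjects (KTot)
open Summit.QuantumFields.BalabanUV.Beta.FP.PerfectObjectsT (KPerf)
open Summit.QuantumFields.BalabanUV.Beta.FP.PerfectRebase (two_le_pow)
open Summit.QuantumFields.BalabanUV.Beta.FP.TransportLimit (linReproSum_of_tendsto)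
open Summit.QuantumFields.BalabanUV.Beta.FP.TransportInfinity (summable_abs_coord_mul_exp_neg_l1)
open Summit.QuantumFields.BalabanUV.Beta.FP.TransportInfinityM (stepColM stepColM_eq wStepM colOf abs_wStepM_le_of_decays
  tendsto_wStepM_of_decays)
open Summit.QuantumFields.BalabanUV.Beta.FP.KSlotHolds (sfStep_mul_smStep_three)
open Summit.QuantumFields.BalabanUV.Beta.FP.PerfectBubbleSandwich (colH_zero_eq_colOf_neg linReproSum_reflect)

/-! ## §1 Off the diagonal the (L1∞) constants of an affine-reproducing kernel map VANISH -/

section Spec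

variable {d N : ℕ}

/-- [folklore] **(L1∞) OFF THE DIAGONAL IS ZERO.**  If the kernel map (entries with absolutely summable second moments) reproduces every affine
fine 1-form from its block sum, then for `κ ≠ l` every coset first-moment family of the entry `w κ l` has the sum `0`:
`LinReproSum N (w κ l) 0` — the computation of an2's `KernelRepresentationSummable.linReproSum_of_reproduces` with its constant
`contourSum N (affine (unitMat l j) 0) κ 0 ∕ N^{2(d+1)}` EVALUATED: the `κ`-component of the test form `affine (unitMat l j) 0` is `[κ = l]·x_j`. -/
theorem linReproSum_of_reproduces_offDiag (hN : N ≠ 0) (w : Fin d → Fin d → (Fin d → ℤ) → ℝ) (hw : ∀ κ l, AbsMoment₂ (w κ l))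
    (h : ∀ (m : Fin d → Fin d → ℝ) (c : Fin d → ℝ), kernelOpSum N w (contourSum N (affine m c)) = affine m c)
    {κ l : Fin d} (hκl : κ ≠ l) : LinReproSum N (w κ l) 0 := by
  have hNr : (N : ℝ) ≠ 0 := by exact_mod_cast hN
  have hNp : ((N : ℝ) ^ (d + 1)) ≠ 0 := pow_ne_zero _ hNr
  have hL0 : ∀ l', ConstReproSum N (w κ l') (if κ = l' then ((N : ℝ) ^ (d + 1))⁻¹ else 0) := fun l' =>
    constReproSum_of_reproduces hN w (fun κ' l'' => summable_of_absMoment₂ (hw κ' l'')) (fun c => by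
      have : (cst c : Form1 d ℝ) = affine 0 c := by funext κ' y; simp [affine, cst]
      rw [this]; exact h 0 c) κ l'
  have h0 : ∀ l' x, cM0Sum N (w κ l') x = if κ = l' then ((N : ℝ) ^ (d + 1))⁻¹ else 0 := fun l' x =>
    (hasSum_cM0Sum (summable_of_absMoment₂ (hw κ l')) x).unique (hL0 l' x)
  intro a j
  have hx := congrFun (congrFun (h (unitMat l j) 0) κ) a
  rw [contourSum_affine] at hx
  have hsm : ((N ^ (d + 2) : ℕ) • unitMat l j : Fin d → Fin d → ℝ) = (N : ℝ) • ((N : ℝ) ^ (d + 1) • unitMat l j) := by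
    funext l' j'
    simp only [Pi.smul_apply, nsmul_eq_mul, smul_eq_mul, Nat.cast_pow]
    ring
  rw [hsm, kernelOpSum_affine w hw] at hx
  simp only [h0] at hx
  simp only [Pi.smul_apply, smul_eq_mul, unitMat, ite_and, mul_ite, mul_one, mul_zero, ite_mul, zero_mul,
    Finset.sum_ite_eq', Finset.mem_univ, if_true, affine, Pi.zero_apply, add_zero,
    Finset.sum_ite_irrel, Finset.sum_const_zero, Finset.sum_add_distrib, Finset.sum_ite_eq] at hx
  simp only [hκl, if_false] at hx
  -- the `κ`-component of the test form `affine (unitMat l j) 0` vanishes identically off the diagonal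
  have hc : contourSum N (affine (unitMat l j) 0) κ 0 = 0 := by
    simp [contourSum, affine, unitMat, hκl]
  rw [hc, zero_mul, add_zero, zero_sub, mul_neg, neg_eq_zero, mul_eq_zero] at hx
  have e : cM1Sum N (w κ l) j a = 0 := hx.resolve_left hNp
  have hS := hasSum_cM1Sum (N := N) (hw κ l) j a
  rw [e] at hS
  simpa only [Pi.zero_apply] using hS

/-- [folklore] … for every kernel-represented `InfiniteVolumeSpec` (`AffineReproduction.hAff_of_spec`). -/
theorem linReproSum_of_spec_offDiag [NeZero N] (Sp : InfiniteVolumeSpec d N) (w : Fin d → Fin d → (Fin d → ℤ) → ℝ)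
    (hw : ∀ κ l, AbsMoment₂ (w κ l)) (hrep : Sp.H = kernelOpSum N w) {κ l : Fin d} (hκl : κ ≠ l) : LinReproSum N (w κ l) 0 :=
  linReproSum_of_reproduces_offDiag (NeZero.ne N) w hw (fun m c => by rw [← hrep]; exact hAff_of_spec Sp m c) hκl

/-- [folklore] **THE KRONECKER FIRST-MOMENT ROW OF THE TYPED SOLUTION OPERATOR's KERNEL `wH`** (`= MinimiserIdentityForm.wK` at `d + 1 = 4`):
`LinReproSum N (wH κ l) 0` for `κ ≠ l` — the off-diagonal companion of `KernelSpecInstance.lowMomentsSum_specK`. -/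
theorem linReproSum_wH_offDiag [NeZero N] {κ l : Fin (d + 1)} (hκl : κ ≠ l) : LinReproSum N (wH (N := N) κ l) 0 :=
  linReproSum_of_spec_offDiag (specK (N := N)) (wH (N := N)) absMoment₂_wH rfl hκl

end Spec

/-! ## §2 The `m`-step column at finite level: off-diagonal (L1∞) constants are zero -/

section Column

variable {d : ℕ} {Lc : ℕ} [NeZero Lc]

/-- [our object] **OFF-DIAGONAL (L1∞) OF THE `m`-STEP COLUMN IS ZERO** at every finite step `j` (`TransportInfinityM.linReproSum_stepColM`'s
computation with Kronecker mass `0` and fine-kernel constant `0`: `linReproSum_dilate` of zero data is zero data). -/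
theorem linReproSum_stepColM_offDiag (j m : ℕ) {κ l : Fin (d + 1)} (hκl : κ ≠ l) :
    LinReproSum (Lc ^ m) (stepColM (d := d) Lc j m κ l) 0 := by
  have hM : Lc ^ j ≠ 0 := pow_ne_zero _ (NeZero.ne Lc)
  have hw : ConstReproSum (Lc ^ j * Lc ^ m) (wH (N := Lc ^ (j + m)) κ l) 0 := by
    rw [← pow_add]
    have h := (lowMomentsSum_specK (N := Lc ^ (j + m))).1 κ l
    rw [if_neg hκl] at h
    exact h
  have hC' : LinReproSum (Lc ^ j * Lc ^ m) (wH (N := Lc ^ (j + m)) κ l) 0 := by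
    rw [← pow_add]
    exact linReproSum_wH_offDiag hκl
  intro a μ
  have hleg : ∀ i ∈ LegIdx d (Lc ^ j), HasSum (fun p : Fin (d + 1) → ℤ => (cosetInd (Lc ^ m) (a - p) * p μ) •
      ((((Lc ^ j : ℕ) : ℝ) ^ (d + 2))⁻¹ * wH (N := Lc ^ (j + m)) κ l (legOff κ i - ((Lc ^ j : ℕ) : ℤ) • p)))
      ((((Lc ^ j : ℕ) : ℝ) ^ (d + 2))⁻¹ * ((((Lc ^ j : ℕ) : ℝ))⁻¹ * (((legOff κ i μ : ℤ) : ℝ) * 0 - (0 : Fin (d + 1) → ℝ) μ))) := by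
    intro i _
    refine (((linReproSum_dilate hM hw hC' (legOff κ i)) a μ).mul_left ((((Lc ^ j : ℕ) : ℝ) ^ (d + 2))⁻¹)).congr_fun
      fun p => ?_
    simp only [zsmul_eq_mul, Int.cast_mul]
    ring
  have hs := hasSum_sum hleg
  have hv : ∑ i ∈ LegIdx d (Lc ^ j),
      (((Lc ^ j : ℕ) : ℝ) ^ (d + 2))⁻¹ * ((((Lc ^ j : ℕ) : ℝ))⁻¹ * (((legOff κ i μ : ℤ) : ℝ) * 0 - (0 : Fin (d + 1) → ℝ) μ)) = 0 :=
    Finset.sum_eq_zero fun i _ => by simp only [Pi.zero_apply, mul_zero, sub_zero]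
  rw [hv] at hs
  rw [Pi.zero_apply]
  refine hs.congr_fun fun p => ?_
  rw [stepColM_eq, Finset.smul_sum]

/-- [our object] **OFF-DIAGONAL (L1) OF THE RENORMALISED WEIGHT `wStepM` IS ZERO** (`d = 3`), every `m`, `j`. -/
theorem linReproSum_wStepM_offDiag (m j : ℕ) {κ l : Fin 4} (hκl : κ ≠ l) : LinReproSum (Lc ^ m) (wStepM Lc m j κ l) 0 := by
  have h := linReproSum_const_mul (linReproSum_stepColM_offDiag (d := 3) (Lc := Lc) j m hκl) ((Lc : ℝ) ^ (5 * j))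
  have e : (fun μ : Fin 4 => (Lc : ℝ) ^ (5 * j) * (0 : Fin 4 → ℝ) μ) = 0 := by
    funext μ; simp only [Pi.zero_apply, mul_zero]
  rw [e] at h
  exact h

end Column

/-! ## §3 The perfect column: the zero passes through the dominated limit `j → ∞` -/

section Limit

variable {Lc : ℕ} [NeZero Lc] (m : ℕ) {wInf : EKer 4} {A δ : ℝ}

/-- [our object] **OFF-DIAGONAL (L1∞) OF ANY DOMINATED ENTRYWISE LIMIT OF `j ↦ wStepM Lc m j` IS ZERO** (`TransportLimit.linReproSum_of_tendsto` with
constants `0 → 0`). -/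
theorem linReproSum_offDiag_of_tendsto_wStepM (hA : 0 ≤ A) (hδ : 0 < δ)
    (hbound : ∀ j κ l u, |wStepM Lc m j κ l u| ≤ A * Real.exp (-δ * l1 u))
    (hlim : ∀ κ l u, Tendsto (fun j => wStepM Lc m j κ l u) atTop (𝓝 (wInf κ l u))) {κ l : Fin 4} (hκl : κ ≠ l) :
    LinReproSum (Lc ^ m) (wInf κ l) 0 :=
  linReproSum_of_tendsto (w := fun j => wStepM Lc m j κ l) (C := fun _ => 0) (summable_abs_coord_mul_exp_neg_l1 hA hδ)
    (fun j u => hbound j κ l u) (hlim κ l) (fun j => linReproSum_wStepM_offDiag m j hκl) (fun _ => tendsto_const_nhds)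

variable {sf sm : ℕ → ℝ} (hunit : ∀ j, sf j * sm j = (Lc : ℝ) ^ (5 * j)) {C δK : ℝ}
include hunit

/-- [our object] **OFF-DIAGONAL (L1∞) OF THE COLUMN OF THE PERFECT `m`-STEP RESOLVENT IS ZERO** (generic bond units; the (CONV-C)-type `j`-uniform
`Decays` bound `hK` and the all-scales deviations `hKall`, `θ < 1`, of the rescaled (j, m)-resolvents — the hypotheses of
`TransportInfinityM.entryHyps_perfCol`). -/
theorem linReproSum_perfCol_offDiag (hC : 0 ≤ C) (hδK : 0 < δK)
    (hK : ∀ j, Decays (unitK (sf j) (sm j) (KTot (d := 3) (Lc ^ (j + m)) (Lc ^ j))) C δK) {c δ θ : ℝ}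
    (hKall : ∀ k j, Decays (unitK (sf (k + j)) (sm (k + j)) (KTot (d := 3) (Lc ^ (k + j + m)) (Lc ^ (k + j)))
      - unitK (sf k) (sm k) (KTot (d := 3) (Lc ^ (k + m)) (Lc ^ k))) (c * θ ^ k) δ) (hθ1 : θ < 1)
    {κ l : Fin 4} (hκl : κ ≠ l) : LinReproSum (Lc ^ m) (colOf (KPerf (d := 3) Lc sf sm m) κ l) 0 :=
  linReproSum_offDiag_of_tendsto_wStepM m hC hδK (abs_wStepM_le_of_decays hunit m hK) (tendsto_wStepM_of_decays hunit m hKall hθ1) hκl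

omit hunit in
/-- [our object] **… UNCONDITIONAL AT `m = 1`** (`d = 3`, `2 ≤ Lc`, adopted units `sfStep`∕`smStep 3`): gan24's `convCKWall_holds` BY NAME. -/
theorem linReproSum_perfCol_one_offDiag_holds (hLc : 2 ≤ Lc) {κ l : Fin 4} (hκl : κ ≠ l) :
    LinReproSum Lc (colOf (KPerf (d := 3) Lc (sfStep Lc) (smStep 3 Lc) 1) κ l) 0 := by
  obtain ⟨C, δ, cK, θ, hδ, _hθ0, hθ1, hK, hKall⟩ := convCKWall_holds hLc
  have h := linReproSum_perfCol_offDiag 1 (sfStep_mul_smStep_three Lc) ((hK 0).nonneg (Sum.inl 0)) hδ (fun j => hK j)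
    (fun k j => hKall k j) hθ1 hκl
  rwa [pow_one] at h

omit hunit in
/-- [our object] **THE KRONECKER FIRST-MOMENT ROW OF THE PERFECT `m`-FOLD TRANSPORT COLUMN — UNCONDITIONAL, EVERY `m ≥ 1`** (`d = 3`, `2 ≤ Lc`):
`LinReproSum (Lc^m) (colOf (KPerf Lc (sfStep Lc) (smStep 3 Lc) m) κ l) 0` for `κ ≠ l` — by REBASE (`RealRateKMHolds.KPerf_eq_KPerf_pow_base_holds`)
from the `m = 1` case at base `Lc^m`.  The companion of `StepLawKHolds.entryHyps_perfCol_holds`' `.lin`. -/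
theorem linReproSum_perfCol_offDiag_holds (hLc : 2 ≤ Lc) {m : ℕ} (hm : 1 ≤ m) {κ l : Fin 4} (hκl : κ ≠ l) :
    LinReproSum (Lc ^ m) (colOf (KPerf (d := 3) Lc (sfStep Lc) (smStep 3 Lc) m) κ l) 0 := by
  rw [KPerf_eq_KPerf_pow_base_holds hLc hm]
  exact linReproSum_perfCol_one_offDiag_holds (Lc := Lc ^ m) (two_le_pow hLc hm) hκl

end Limit

/-! ## §4 Packaging: the Kronecker shape, the base-`0` column, the two spellings of first-bond divergence-freeness -/

section Packaging

variable {D N : ℕ}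

/-- [folklore] (L1∞) for every entry with SOME constant, and `0` off the diagonal ⟹ the KRONECKER SHAPE
`LinReproSum N (w κ l) (μ ↦ if κ = l then C1 κ μ else 0)` consumed by `MomentTransferKronecker`. -/
theorem linReproSum_kronecker_of_offDiag {w : Fin D → Fin D → (Fin D → ℤ) → ℝ}
    (hlin : ∀ κ l, ∃ C : Fin D → ℝ, LinReproSum N (w κ l) C) (hoff : ∀ κ l, κ ≠ l → LinReproSum N (w κ l) 0) :
    ∃ C1 : Fin D → Fin D → ℝ, ∀ κ l, LinReproSum N (w κ l) (fun μ => if κ = l then C1 κ μ else 0) := by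
  choose C hC using hlin
  refine ⟨fun κ => C κ κ, fun κ l => ?_⟩
  by_cases h : κ = l
  · subst h
    simp only [if_true]
    exact hC κ κ
  · simp only [if_neg h]
    exact hoff κ l h

/-- [folklore] Off-diagonal (L1∞) of the base-`0` column `c ↦ colH K n a 0 c` from that of `colOf K` (reflection `u ↦ −u`: constants `0 ↦ −0`). -/
theorem linReproSum_colH_zero_offDiag {K : MKer (3 + 1) (Fib 3)} {n : ℕ} (hoff : ∀ κ l : Fin 4, κ ≠ l → LinReproSum n (colOf K κ l) 0)
    (κ l : Fin 4) (h : κ ≠ l) : LinReproSum n (colH K n l 0 κ) 0 := by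
  have e : colH K n l 0 κ = fun u => colOf K κ l (-u) := funext fun u => colH_zero_eq_colOf_neg K n l κ u
  rw [e]
  have h' := linReproSum_reflect (hoff κ l h)
  have e0 : (fun μ : Fin 4 => -(0 : Fin 4 → ℝ) μ) = 0 := by funext μ; simp only [Pi.zero_apply, neg_zero]
  rw [e0] at h'
  exact h'

/-- [folklore] leaf-01's `unitVec` spelling of first-bond divergence-freeness (`FineHessianWard.divFree_fineHessA_of_wardLaws`' conclusion) ⟹ the
`Pi.single` spelling of `MomentTransferKroneckerWard` / an2's `hasSum_zero_of_divFree`. -/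
theorem divFree_single_of_unitVec {P : EKer₂ 4}
    (hdiv : ∀ (l' : Fin 4) (u' u : Site 4), ∑ κ' : Fin 4, (P κ' l' (u - unitVec κ') u' - P κ' l' u u') = 0)
    (e : Fin 4) (u' u : Site 4) : ∑ c : Fin 4, (P c e (u - Pi.single c 1) u' - P c e u u') = 0 := by
  have h := hdiv e u' u
  simp only [unitVec_eq_single] at h
  exact h

end Packaging

end Summit.QuantumFields.BalabanUV.Beta.FP.PerfectColumnKronecker

end
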